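import Literature.Analysis.FluidPDE.KNSSTypeIRateLiouville
import Literature.Analysis.FluidPDE.KNSSTypeIRateCoreProofs
import Literature.Analysis.FluidPDE.KNSSTypeIRateLiouvilleMild
import Literature.Analysis.FluidPDE.KNSSLiouvillePlanar
import Literature.Analysis.FluidPDE.KNSSRegularityPlanarOfSpace
import Literature.Analysis.FluidPDE.ClassicalSolutionCalculus
import Literature.Analysis.FluidPDE.MildSolutionProofs
import Mathlib.Analysis.Calculus.BumpFunction.Normed
import HarnessLib

/-!
# KNSS 2009, Theorem 6.2, Liouville step: descent to the plane and the planar half from Theorem 5.1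

Analysis/FluidPDE proofs file (theorems only) completing the reduction of the first
("horizontal") half of the Liouville step of the proof of Koch–Nadirashvili–Seregin–Šverák,
Acta Math. 203 (2009) = arXiv:0709.3599, Theorem 6.2 (named fact
`KNSS2009_typeI_rate_liouville_horizontal`, `KNSSTypeIRateLiouville`; p. 13: "`w` is independent
of the `x₂`-variable. Applying Theorem 5.1 and Remark 6.1 to the field `(w₁, w₃)` …") to
Theorem 5.1 as printed (`KNSS2009_liouville_planar`, `KNSSLiouville`). `KNSSTypeIRateLiouvilleMild`
proved that half for every field whose planar trace `V(t, y) = (W₀, W₂)(t, (y₀, 0, y₁))` is a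
bounded weak solution on `ℝ² × (−∞, 0)`; this file proves that it is:

* `IsBoundedWeakNSSolutionOn.planarTrace_of_lineInvariant` — **descent of bounded weak
  solutions along an ignorable coordinate**: if `u` is a bounded weak solution of Navier–Stokes
  (KNSS's class `IsBoundedWeakNSSolutionOn`, §4 (ii)) on `ℝ³ × I`, jointly continuous, invariant
  under `x ↦ x + δe₁` (`e₁` the unit vector of the Lean coordinate `1`, KNSS's `x₂`) and with
  weakly divergence-free slices, then its planar trace `V` is a bounded weak solution on
  `ℝ² × I`. Proof: a planar test field `ψ` (resp. scalar test function `θ`) is lifted to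
  `Ψ(t, x) = χ(x₁) ψ(t, Px)` (resp. `χ(x₁) θ(Px)`) with a normalised bump `χ`, `∫ χ = 1`
  (`exists_smooth_bump_integral_one`); `Ψ` is a space–time test field on `I × ℝ³` with
  divergence-free slices (`isSpaceTimeTestOn_bumpLift`, `divergence_bumpLift`:
  `div Ψ = χ (div ψ)∘P` because `ψ` has no `e₁`-component), and slice by slice
  `∂ₜΨ = χ (∂ₜψ)∘P`, `DΨ[u] = χ (Dψ∘P)[Pu] + χ' u₁ ψ∘P`, `ΔΨ = χ (Δψ)∘P + χ'' ψ∘P`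
  (`timeDeriv_bumpLift`, `hasFDerivAt_bumpLift`, `laplacian_bumpLift`; the cross term
  `2 Σᵢ ∂ᵢχ ∂ᵢ(ψ∘P)` vanishes since `P e₁ = 0`), so that Fubini along the lines parallel to `e₁`
  (`integral_eq_integral_integral_line`, `OseenKernelLineIntegrals`) turns the weak identity of `u`
  tested with `Ψ` into `(∫χ)·(identity of V tested with ψ) + (∫χ')·(…) + (∫χ'')·(…)`, i.e. the
  planar identity, `∫ χ' = ∫ χ'' = 0` (`integral_bumpLift_pairing_eq`); likewise for the
  divergence constraint (`integral_inner_gradient_bumpLift_scalar_eq`).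
* `KNSS2009_typeI_rate_liouville_horizontal_of_planar :
    KNSS2009_liouville_planar → KNSS2009_typeI_rate_liouville_horizontal` — with
  `isBoundedWeakNSSolutionOn_of_oseen` and
  `KNSS2009_typeI_rate_liouville_horizontal_of_weak_planar` (`KNSSTypeIRateLiouvilleMild`);
* `KNSS2009_typeI_rate_liouville_of_planar : KNSS2009_liouville_planar →
    KNSS2009_typeI_rate_liouville` (with the proved axial half,
  `KNSS2009_typeI_rate_liouville_of_horizontal`), and
  `KNSS2009_typeI_rate_liouville_of_regularity_planar :
    KNSS2009_regularity_boundedWeak_ancient_planar → KNSS2009_typeI_rate_liouville`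
  (`KNSS2009_liouville_planar_of_regularity`, `KNSSLiouvillePlanar`); fed into the assembly of
  Theorem 6.2 (`KNSS2009_regularity_typeI_rate_of_core`, `KNSSTypeIRateCoreProofs`) this gives
  `KNSS2009_regularity_typeI_rate_of_core_of_regularity_planar`; and since the planar §4 fact is
  itself reduced to the spatial one (`KNSS2009_liouville_planar_of_ancient`,
  `KNSSRegularityPlanarOfSpace`), also `KNSS2009_typeI_rate_liouville_of_regularity_ancient :
    KNSS2009_regularity_boundedWeak_ancient → KNSS2009_typeI_rate_liouville` — the same trust
  base as the tree's Theorems 5.2–5.3.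

So the Liouville ingredient of Steps 5–6 of the proof of Theorem 6.2 now rests on exactly the
§4 regularity fact of the planar Liouville theorem (Theorem 5.1 is assumed once in the tree).

## Mathlib / tree search

Tree: `IsBoundedWeakNSSolutionOn` (`KNSSLiouville`); space–time test fields and their slice
API (`WeakSolution`, `HeatDuhamelBack`: `timeDeriv_top`, `fderiv_top`, `laplacian_top`;
`ClassicalSolutionCalculus`: `hasCompactSupport_slice`, `hasDerivAt_time`); `laplacian_smul_apply`
(`MildSolutionProofs`), `divergence_eq_sum_inner_fderiv` (`VectorCalculus`),
`integrable_inner_of_aestronglyMeasurable_of_norm_le` (`AncientMildPairing`),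
`integrable_inner_clm_apply_of_norm_le` (`AncientMildWeak`), the line parametrisation and Fubini
of `OseenKernelLineIntegrals`; the converse lift `ℝ² → ℝ³` along the index `2` is
`PlanarLiftWeak` (not used). Mathlib: `ContDiffBump.normed`,
`integral_eq_zero_of_hasDerivAt_of_integrable`, `laplacian_eq_iteratedFDeriv_orthonormalBasis`,
`ContinuousLinearMap.iteratedFDeriv_comp_right`, `ContDiffAt.laplacian_CLM_comp_left`,
`iteratedFDeriv_apply_eq_iteratedDeriv_mul_prod`, `OrthonormalBasis.sum_repr'`,
`HasFDerivAt.smul/mul`, `HasCompactSupport.intro`.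

## References

* G. Koch, N. Nadirashvili, G. Seregin, V. Šverák, Acta Math. 203 (2009) 83–105 =
  arXiv:0709.3599 (arXiv pages): proof of Theorem 6.2, p. 13; Theorem 5.1, p. 9; §4 (ii), p. 8.
  [KochNadirashviliSereginSverak2009]
* A. J. Majda, A. L. Bertozzi, *Vorticity and Incompressible Flow*, CUP 2002, §2.3.1
  (`2½`-dimensional flows). [MajdaBertozziCUP2002]
-/

noncomputable section

open MeasureTheory Set Function Filter TopologicalSpace WithLp InnerProductSpace
open _root_.Topology
open scoped RealInnerProductSpace Laplacian ContDiff

namespace Literature.Analysis.FluidPDE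

/-! ### A normalised bump on the line -/

/-- **A smooth compactly supported `χ` on `ℝ` with `∫ χ = 1`** (a normalised `ContDiffBump`);
`χ`, `χ'`, `χ''` are integrable and `∫ χ' = ∫ χ'' = 0`
(`integral_eq_zero_of_hasDerivAt_of_integrable`). [folklore] -/
theorem exists_smooth_bump_integral_one :
    ∃ χ : ℝ → ℝ, ContDiff ℝ ∞ χ ∧ HasCompactSupport χ ∧ Integrable χ ∧ (∫ r, χ r = 1) ∧
      Integrable (deriv χ) ∧ (∫ r, deriv χ r = 0) ∧
      Integrable (deriv (deriv χ)) ∧ (∫ r, deriv (deriv χ) r = 0) := by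
  let b : ContDiffBump (0 : ℝ) := ⟨1, 2, one_pos, one_lt_two⟩
  set χ : ℝ → ℝ := b.normed volume with hχ
  have hs : ContDiff ℝ ∞ χ := b.contDiff_normed
  have hc : HasCompactSupport χ := b.hasCompactSupport_normed
  have hi : Integrable χ := hs.continuous.integrable_of_hasCompactSupport hc
  have hs1 : ContDiff ℝ ∞ (deriv χ) := hs.deriv'
  have hc1 : HasCompactSupport (deriv χ) := hc.deriv
  have hi1 : Integrable (deriv χ) := hs1.continuous.integrable_of_hasCompactSupport hc1
  have hs2 : ContDiff ℝ ∞ (deriv (deriv χ)) := hs1.deriv'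
  have hc2 : HasCompactSupport (deriv (deriv χ)) := hc1.deriv
  have hi2 : Integrable (deriv (deriv χ)) := hs2.continuous.integrable_of_hasCompactSupport hc2
  have hd0 : ∀ x, HasDerivAt χ (deriv χ x) x := fun x =>
    ((hs.differentiable (by simp)) x).hasDerivAt
  have hd1 : ∀ x, HasDerivAt (deriv χ) (deriv (deriv χ) x) x := fun x =>
    ((hs1.differentiable (by simp)) x).hasDerivAt
  exact ⟨χ, hs, hc, hi, b.integral_normed, hi1,
    integral_eq_zero_of_hasDerivAt_of_integrable hd0 hi1 hi, hi2,
    integral_eq_zero_of_hasDerivAt_of_integrable hd1 hi2 hi1⟩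

/-! ### The projection to the plane of the coordinates `0, 2` and the embedding of the plane -/

section Gadgets

/- Throughout, `P : ℝ³ → ℝ²` and `L : ℝ² → ℝ³` are continuous linear maps with
`P x = (x₀, x₂)` and `L y = (y₀, 0, y₁)` (hypotheses `hP`, `hL`; such maps are written down in
the proof of the descent theorem); `e₁ = EuclideanSpace.single 1 1`. -/

variable {P : EuclideanSpace ℝ (Fin 3) →L[ℝ] EuclideanSpace ℝ (Fin 2)}
  {L : EuclideanSpace ℝ (Fin 2) →L[ℝ] EuclideanSpace ℝ (Fin 3)}

/-- `P (L y) = y`. [folklore] -/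
theorem planarProj_embed (hP : ∀ v : EuclideanSpace ℝ (Fin 3), P v = toLp 2 ![v 0, v 2])
    (hL : ∀ y : EuclideanSpace ℝ (Fin 2), L y = toLp 2 ![y 0, 0, y 1]) (y : EuclideanSpace ℝ (Fin 2)) :
    P (L y) = y := by
  rw [hP, hL]; ext j; fin_cases j <;> simp

/-- `L (P x) + x₁ e₁ = x`. [folklore] -/
theorem embed_planarProj_add (hP : ∀ v : EuclideanSpace ℝ (Fin 3), P v = toLp 2 ![v 0, v 2])
    (hL : ∀ y : EuclideanSpace ℝ (Fin 2), L y = toLp 2 ![y 0, 0, y 1]) (x : EuclideanSpace ℝ (Fin 3)) :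
    L (P x) + EuclideanSpace.single 1 (x 1) = x := by
  rw [hP, hL]; ext j; fin_cases j <;> simp

/-- `L` and `P` are adjoint: `⟪z, L y⟫ = ⟪P z, y⟫`. [folklore] -/
theorem inner_embed_right (hP : ∀ v : EuclideanSpace ℝ (Fin 3), P v = toLp 2 ![v 0, v 2])
    (hL : ∀ y : EuclideanSpace ℝ (Fin 2), L y = toLp 2 ![y 0, 0, y 1])
    (z : EuclideanSpace ℝ (Fin 3)) (y : EuclideanSpace ℝ (Fin 2)) : ⟪z, L y⟫ = ⟪P z, y⟫ := by
  rw [hL, hP]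
  simp [PiLp.inner_apply, Fin.sum_univ_three, Fin.sum_univ_two, mul_comm]

/-- `‖P z‖ ≤ ‖z‖`. [folklore] -/
theorem norm_planarProj_le (hP : ∀ v : EuclideanSpace ℝ (Fin 3), P v = toLp 2 ![v 0, v 2])
    (z : EuclideanSpace ℝ (Fin 3)) : ‖P z‖ ≤ ‖z‖ := by
  rw [hP, EuclideanSpace.norm_eq, EuclideanSpace.norm_eq, Fin.sum_univ_two, Fin.sum_univ_three]
  apply Real.sqrt_le_sqrt
  simp only [Matrix.cons_val_zero, Matrix.cons_val_one, Real.norm_eq_abs, sq_abs]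
  nlinarith [sq_nonneg (z 1)]

/-- The points of the line through `(w₀, ·, w₁)`: `(w₀, r, w₁) = L w + r e₁`. [folklore] -/
theorem toLp_line_eq_embed_add (hL : ∀ y : EuclideanSpace ℝ (Fin 2), L y = toLp 2 ![y 0, 0, y 1])
    (w : EuclideanSpace ℝ (Fin 2)) (r : ℝ) :
    (toLp 2 ![w 0, r, w 1] : EuclideanSpace ℝ (Fin 3)) = L w + EuclideanSpace.single 1 r := by
  rw [hL]; ext j; fin_cases j <;> simp

/-! ### Calculus of the lifted test fields `x ↦ χ(x₁) L(f(Px))` -/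

/-- **Derivative of the lifted field**:
`D(χ(x₁) L f(Px)) = χ(x₁) L ∘ Df(Px) ∘ P + (χ'(x₁) dx₁) ⊗ L f(Px)`. [folklore] -/
theorem hasFDerivAt_bumpLift {χ : ℝ → ℝ} (hχ : ContDiff ℝ 2 χ)
    {f : EuclideanSpace ℝ (Fin 2) → EuclideanSpace ℝ (Fin 2)} (hf : ContDiff ℝ 2 f)
    (x : EuclideanSpace ℝ (Fin 3)) :
    HasFDerivAt (fun x : EuclideanSpace ℝ (Fin 3) => χ (x 1) • L (f (P x)))
      (χ (x 1) • (L.comp ((fderiv ℝ f (P x)).comp P)) +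
        (deriv χ (x 1) • (EuclideanSpace.proj (1 : Fin 3) :
          EuclideanSpace ℝ (Fin 3) →L[ℝ] ℝ)).smulRight (L (f (P x)))) x := by
  have hχd : DifferentiableAt ℝ χ (x 1) := (hχ.differentiable (by norm_num)) _
  have hfd : DifferentiableAt ℝ f (P x) := (hf.differentiable (by norm_num)) _
  have h1 : HasFDerivAt (fun x : EuclideanSpace ℝ (Fin 3) => χ (x 1))
      (deriv χ (x 1) • (EuclideanSpace.proj (1 : Fin 3) : EuclideanSpace ℝ (Fin 3) →L[ℝ] ℝ)) x :=
    hχd.hasDerivAt.comp_hasFDerivAt x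
      ((EuclideanSpace.proj (1 : Fin 3) : EuclideanSpace ℝ (Fin 3) →L[ℝ] ℝ).hasFDerivAt)
  have h2 : HasFDerivAt (fun x : EuclideanSpace ℝ (Fin 3) => L (f (P x)))
      (L.comp ((fderiv ℝ f (P x)).comp P)) x :=
    L.hasFDerivAt.comp x (hfd.hasFDerivAt.comp x P.hasFDerivAt)
  exact h1.smul h2

/-- **The lifted field has planar divergence**: `div (χ(x₁) L f(Px)) = χ(x₁) (div f)(Px)`
(the `e₁`-component of `L f` vanishes, so `χ'` does not contribute). [folklore] -/
theorem divergence_bumpLift (hP : ∀ v : EuclideanSpace ℝ (Fin 3), P v = toLp 2 ![v 0, v 2])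
    (hL : ∀ y : EuclideanSpace ℝ (Fin 2), L y = toLp 2 ![y 0, 0, y 1])
    {χ : ℝ → ℝ} (hχ : ContDiff ℝ 2 χ)
    {f : EuclideanSpace ℝ (Fin 2) → EuclideanSpace ℝ (Fin 2)} (hf : ContDiff ℝ 2 f)
    (x : EuclideanSpace ℝ (Fin 3)) :
    VectorCalculus.divergence (fun x : EuclideanSpace ℝ (Fin 3) => χ (x 1) • L (f (P x))) x =
      χ (x 1) * VectorCalculus.divergence f (P x) := by
  rw [divergence_eq_sum_inner_fderiv (EuclideanSpace.basisFun (Fin 3) ℝ),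
    divergence_eq_sum_inner_fderiv (EuclideanSpace.basisFun (Fin 2) ℝ),
    (hasFDerivAt_bumpLift (P := P) (L := L) hχ hf x).fderiv]
  have hPe : ∀ i : Fin 3, P (EuclideanSpace.single i (1 : ℝ)) =
      if i = 0 then EuclideanSpace.single 0 (1 : ℝ) else
        if i = 2 then EuclideanSpace.single 1 (1 : ℝ) else 0 := fun i => by
    rw [hP]; ext j; fin_cases i <;> fin_cases j <;> simp
  simp only [Fin.sum_univ_three, Fin.sum_univ_two, EuclideanSpace.basisFun_apply,
    _root_.FunLike.coe_add, Pi.add_apply, _root_.FunLike.coe_smul, Pi.smul_apply,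
    ContinuousLinearMap.comp_apply, ContinuousLinearMap.smulRight_apply, hPe,
    EuclideanSpace.inner_single_left, hL]
  simp
  ring

/-- **The Laplacian commutes with the projection**: `Δ(g ∘ P)(x) = (Δg)(Px)` for `C²` maps `g`
(`P` is a coordinate projection: `Σᵢ D²g(Px)[Peᵢ, Peᵢ]` runs over `Pe₀ = e₀'`, `Pe₁ = 0`,
`Pe₂ = e₁'`). [folklore] -/
theorem laplacian_comp_planarProj (hP : ∀ v : EuclideanSpace ℝ (Fin 3), P v = toLp 2 ![v 0, v 2])
    {F : Type*} [NormedAddCommGroup F] [NormedSpace ℝ F]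
    {g : EuclideanSpace ℝ (Fin 2) → F} (hg : ContDiff ℝ 2 g) (x : EuclideanSpace ℝ (Fin 3)) :
    Δ (fun x => g (P x)) x = Δ g (P x) := by
  have hPe : ∀ i : Fin 3, P (EuclideanSpace.single i (1 : ℝ)) =
      if i = 0 then EuclideanSpace.single 0 (1 : ℝ) else
        if i = 2 then EuclideanSpace.single 1 (1 : ℝ) else 0 := fun i => by
    rw [hP]; ext j; fin_cases i <;> fin_cases j <;> simp
  rw [laplacian_eq_iteratedFDeriv_orthonormalBasis _ (EuclideanSpace.basisFun (Fin 3) ℝ),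
    laplacian_eq_iteratedFDeriv_orthonormalBasis _ (EuclideanSpace.basisFun (Fin 2) ℝ)]
  have hcomp : (fun x => g (P x)) = g ∘ P := rfl
  simp only [hcomp, P.iteratedFDeriv_comp_right hg x (i := 2) le_rfl,
    ContinuousMultilinearMap.compContinuousLinearMap_apply, EuclideanSpace.basisFun_apply,
    Fin.sum_univ_three, Fin.sum_univ_two]
  have hv : ∀ i : Fin 3, (fun k : Fin 2 => P ((![EuclideanSpace.single i (1 : ℝ),
      EuclideanSpace.single i (1 : ℝ)] : Fin 2 → EuclideanSpace ℝ (Fin 3)) k)) =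
      ![P (EuclideanSpace.single i (1 : ℝ)), P (EuclideanSpace.single i (1 : ℝ))] := fun i => by
    funext k; fin_cases k <;> rfl
  simp only [hv, hPe]
  simp only [Fin.isValue, ↓reduceIte, Fin.reduceEq]
  rw [(iteratedFDeriv ℝ 2 g (P x)).map_coord_zero (m := ![(0 : EuclideanSpace ℝ (Fin 2)), 0]) 0
    rfl, add_zero]

/-- **The Laplacian of a function of the coordinate `x₁` alone** is its second derivative:
`Δ(χ(x₁)) = χ''(x₁)`. [folklore] -/
theorem laplacian_comp_coord_one {χ : ℝ → ℝ} (hχ : ContDiff ℝ 2 χ) (x : EuclideanSpace ℝ (Fin 3)) :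
    Δ (fun x : EuclideanSpace ℝ (Fin 3) => χ (x 1)) x = iteratedDeriv 2 χ (x 1) := by
  rw [laplacian_eq_iteratedFDeriv_orthonormalBasis _ (EuclideanSpace.basisFun (Fin 3) ℝ)]
  have hcomp : (fun x : EuclideanSpace ℝ (Fin 3) => χ (x 1)) =
      χ ∘ (EuclideanSpace.proj (1 : Fin 3) : EuclideanSpace ℝ (Fin 3) →L[ℝ] ℝ) := rfl
  simp only [hcomp, ContinuousLinearMap.iteratedFDeriv_comp_right _ hχ x (i := 2) le_rfl,
    ContinuousMultilinearMap.compContinuousLinearMap_apply, EuclideanSpace.basisFun_apply,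
    Fin.sum_univ_three, iteratedFDeriv_apply_eq_iteratedDeriv_mul_prod, Fin.prod_univ_two]
  simp

/-- **Laplacian of the lifted field**: `Δ(χ(x₁) L f(Px)) = χ(x₁) L (Δf)(Px) + χ''(x₁) L f(Px)`
(Leibniz rule `laplacian_smul_apply`; the cross term `2Σᵢ ∂ᵢχ ∂ᵢ(L f ∘ P)` is `2χ' L Df(Px)[Pe₁] = 0`).
[folklore] -/
theorem laplacian_bumpLift (hP : ∀ v : EuclideanSpace ℝ (Fin 3), P v = toLp 2 ![v 0, v 2])
    {χ : ℝ → ℝ} (hχ : ContDiff ℝ 2 χ)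
    {f : EuclideanSpace ℝ (Fin 2) → EuclideanSpace ℝ (Fin 2)} (hf : ContDiff ℝ 2 f)
    (x : EuclideanSpace ℝ (Fin 3)) :
    Δ (fun x : EuclideanSpace ℝ (Fin 3) => χ (x 1) • L (f (P x))) x =
      χ (x 1) • L (Δ f (P x)) + iteratedDeriv 2 χ (x 1) • L (f (P x)) := by
  have hPe1 : P (EuclideanSpace.single 1 (1 : ℝ)) = 0 := by
    rw [hP]; ext j; fin_cases j <;> simp
  have hc2 : ContDiff ℝ 2 fun x : EuclideanSpace ℝ (Fin 3) => χ (x 1) :=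
    hχ.comp (EuclideanSpace.proj (1 : Fin 3) : EuclideanSpace ℝ (Fin 3) →L[ℝ] ℝ).contDiff
  have hfP : ContDiff ℝ 2 fun x : EuclideanSpace ℝ (Fin 3) => f (P x) := hf.comp P.contDiff
  have hF2 : ContDiff ℝ 2 fun x : EuclideanSpace ℝ (Fin 3) => L (f (P x)) := L.contDiff.comp hfP
  rw [laplacian_smul_apply hc2 hF2 x]
  have hΔF : Δ (fun x : EuclideanSpace ℝ (Fin 3) => L (f (P x))) x = L (Δ f (P x)) := by
    have h1 : (fun x : EuclideanSpace ℝ (Fin 3) => L (f (P x))) = L ∘ fun x => f (P x) := rfl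
    rw [h1, ContDiffAt.laplacian_CLM_comp_left hfP.contDiffAt, Function.comp_apply,
      laplacian_comp_planarProj hP hf x]
  have hΔc : Δ (fun x : EuclideanSpace ℝ (Fin 3) => χ (x 1)) x = iteratedDeriv 2 χ (x 1) :=
    laplacian_comp_coord_one hχ x
  have hDc : fderiv ℝ (fun x : EuclideanSpace ℝ (Fin 3) => χ (x 1)) x =
      deriv χ (x 1) • (EuclideanSpace.proj (1 : Fin 3) : EuclideanSpace ℝ (Fin 3) →L[ℝ] ℝ) := by
    have hχd : DifferentiableAt ℝ χ (x 1) := (hχ.differentiable (by norm_num)) _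
    exact (hχd.hasDerivAt.comp_hasFDerivAt x
      ((EuclideanSpace.proj (1 : Fin 3) : EuclideanSpace ℝ (Fin 3) →L[ℝ] ℝ).hasFDerivAt)).fderiv
  have hDF : fderiv ℝ (fun x : EuclideanSpace ℝ (Fin 3) => L (f (P x))) x =
      L.comp ((fderiv ℝ f (P x)).comp P) := by
    have hfd : DifferentiableAt ℝ f (P x) := (hf.differentiable (by norm_num)) _
    exact (L.hasFDerivAt.comp x (hfd.hasFDerivAt.comp x P.hasFDerivAt)).fderiv
  have hcross : ∑ i, (fderiv ℝ (fun x : EuclideanSpace ℝ (Fin 3) => χ (x 1)) x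
      (stdOrthonormalBasis ℝ (EuclideanSpace ℝ (Fin 3)) i)) •
        fderiv ℝ (fun x : EuclideanSpace ℝ (Fin 3) => L (f (P x))) x
          (stdOrthonormalBasis ℝ (EuclideanSpace ℝ (Fin 3)) i) = 0 := by
    set b := stdOrthonormalBasis ℝ (EuclideanSpace ℝ (Fin 3)) with hb
    set T : EuclideanSpace ℝ (Fin 3) →L[ℝ] EuclideanSpace ℝ (Fin 3) :=
      L.comp ((fderiv ℝ f (P x)).comp P) with hT
    rw [hDc, hDF]
    have hterm : ∀ i, ((deriv χ (x 1) • (EuclideanSpace.proj (1 : Fin 3) :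
        EuclideanSpace ℝ (Fin 3) →L[ℝ] ℝ)) (b i)) • T (b i) =
        deriv χ (x 1) • T (⟪b i, EuclideanSpace.single (1 : Fin 3) (1 : ℝ)⟫ • b i) := by
      intro i
      rw [T.map_smul, smul_smul, real_inner_comm, EuclideanSpace.inner_single_left]
      simp
    simp only [hterm, ← Finset.smul_sum, ← map_sum, b.sum_repr']
    rw [hT]
    simp [hPe1]
  rw [hΔF, hΔc, hcross, smul_zero, add_zero]

/-- **Time derivative of the lifted space–time test field**:
`∂ₜ(χ(x₁) L ψ(t, Px)) = χ(x₁) L ∂ₜψ(t, Px)`. [folklore] -/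
theorem timeDeriv_bumpLift {I : Set ℝ} {hI : IsOpen I}
    {ψ : ℝ → EuclideanSpace ℝ (Fin 2) → EuclideanSpace ℝ (Fin 2)}
    (hψ : IsSpaceTimeTestOn (slab (EuclideanSpace ℝ (Fin 2)) I hI) ψ) (χ : ℝ → ℝ) (t : ℝ)
    (x : EuclideanSpace ℝ (Fin 3)) :
    timeDeriv (fun t (x : EuclideanSpace ℝ (Fin 3)) => χ (x 1) • L (ψ t (P x))) t x =
      χ (x 1) • L (timeDeriv ψ t (P x)) :=
  ((L.hasFDerivAt.comp_hasDerivAt t (hψ.hasDerivAt_time t (P x))).const_smul (χ (x 1))).deriv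

/-- The map `r ↦ single 1 r` is continuous. [folklore] -/
theorem continuous_single_one :
    Continuous fun r : ℝ => (EuclideanSpace.single (1 : Fin 3) r : EuclideanSpace ℝ (Fin 3)) := by
  have e : (fun r : ℝ => (EuclideanSpace.single (1 : Fin 3) r : EuclideanSpace ℝ (Fin 3))) =
      fun r => r • EuclideanSpace.single (1 : Fin 3) (1 : ℝ) := funext single_one_eq_smul
  rw [e]; fun_prop

/-- **The lifted space–time test field is a space–time test field on the slab `I × ℝ³`**:
smooth; supported in the compact image of `tsupport ψ × tsupport χ` under
`((t, y), r) ↦ (t, L y + r e₁)`; time support that of `ψ`. [folklore] -/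
theorem isSpaceTimeTestOn_bumpLift (hP : ∀ v : EuclideanSpace ℝ (Fin 3), P v = toLp 2 ![v 0, v 2])
    (hL : ∀ y : EuclideanSpace ℝ (Fin 2), L y = toLp 2 ![y 0, 0, y 1])
    {I : Set ℝ} {hI : IsOpen I}
    {ψ : ℝ → EuclideanSpace ℝ (Fin 2) → EuclideanSpace ℝ (Fin 2)}
    (hψ : IsSpaceTimeTestOn (slab (EuclideanSpace ℝ (Fin 2)) I hI) ψ) {χ : ℝ → ℝ}
    (hχ : ContDiff ℝ ∞ χ) (hχc : HasCompactSupport χ) :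
    IsSpaceTimeTestOn (slab (EuclideanSpace ℝ (Fin 3)) I hI)
      (fun t (x : EuclideanSpace ℝ (Fin 3)) => χ (x 1) • L (ψ t (P x))) := by
  set g : ℝ × EuclideanSpace ℝ (Fin 3) → ℝ × EuclideanSpace ℝ (Fin 2) := fun p => (p.1, P p.2)
    with hg
  have hgc : Continuous g := continuous_fst.prodMk (P.continuous.comp continuous_snd)
  have hgs : ContDiff ℝ ∞ g := contDiff_fst.prodMk (P.contDiff.comp contDiff_snd)
  have hLP := embed_planarProj_add hP hL
  refine ⟨?_, ?_, ?_⟩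
  · change ContDiff ℝ ∞ fun p : ℝ × EuclideanSpace ℝ (Fin 3) => χ (p.2 1) • L (uncurry ψ (g p))
    exact ((hχ.comp ((EuclideanSpace.proj (1 : Fin 3) :
      EuclideanSpace ℝ (Fin 3) →L[ℝ] ℝ).contDiff.comp contDiff_snd)).smul
        (L.contDiff.comp (hψ.contDiff.comp hgs)))
  · set Θ : (ℝ × EuclideanSpace ℝ (Fin 2)) × ℝ → ℝ × EuclideanSpace ℝ (Fin 3) :=
      fun q => (q.1.1, L q.1.2 + EuclideanSpace.single 1 q.2) with hΘ
    have hΘc : Continuous Θ :=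
      (continuous_fst.comp continuous_fst).prodMk
        ((L.continuous.comp (continuous_snd.comp continuous_fst)).add
          (continuous_single_one.comp continuous_snd))
    have hK : IsCompact (Θ '' (tsupport (uncurry ψ) ×ˢ tsupport χ)) :=
      (hψ.hasCompactSupport.prod hχc).image hΘc
    refine HasCompactSupport.intro hK fun p hp => ?_
    change χ (p.2 1) • L (uncurry ψ (g p)) = 0
    by_contra hne
    have h1 : χ (p.2 1) ≠ 0 := fun h => hne (by rw [h, zero_smul])
    have h2 : uncurry ψ (g p) ≠ 0 := fun h => hne (by rw [h, map_zero, smul_zero])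
    refine hp ⟨((g p), p.2 1), ⟨subset_tsupport _ h2, subset_tsupport _ h1⟩, ?_⟩
    rw [hΘ, hg]
    exact Prod.ext rfl (hLP p.2)
  · intro p hp
    have hsub : support (fun p : ℝ × EuclideanSpace ℝ (Fin 3) => χ (p.2 1) • L (uncurry ψ (g p))) ⊆
        g ⁻¹' tsupport (uncurry ψ) := by
      intro q hq
      have h2 : uncurry ψ (g q) ≠ 0 := fun h => hq (by simp only [h, map_zero, smul_zero])
      exact subset_tsupport _ h2
    have hcl : tsupport (fun p : ℝ × EuclideanSpace ℝ (Fin 3) =>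
        χ (p.2 1) • L (uncurry ψ (g p))) ⊆ g ⁻¹' tsupport (uncurry ψ) :=
      closure_minimal hsub ((isClosed_tsupport _).preimage hgc)
    have hp' := hcl hp
    rw [mem_preimage] at hp'
    have := hψ.tsupport_subset hp'
    rw [SetLike.mem_coe, mem_slab] at this ⊢
    exact this

/-- **The lifted scalar test function** `x ↦ χ(x₁) θ(Px)` is a test function on `ℝ³`. [folklore] -/
theorem isTestFunctionOn_bumpLift_scalar
    (hP : ∀ v : EuclideanSpace ℝ (Fin 3), P v = toLp 2 ![v 0, v 2])
    (hL : ∀ y : EuclideanSpace ℝ (Fin 2), L y = toLp 2 ![y 0, 0, y 1])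
    {θ : EuclideanSpace ℝ (Fin 2) → ℝ}
    (hθ : FunctionSpaces.IsTestFunctionOn (⊤ : Opens (EuclideanSpace ℝ (Fin 2))) θ) {χ : ℝ → ℝ}
    (hχ : ContDiff ℝ ∞ χ) (hχc : HasCompactSupport χ) :
    FunctionSpaces.IsTestFunctionOn (⊤ : Opens (EuclideanSpace ℝ (Fin 3)))
      (fun x : EuclideanSpace ℝ (Fin 3) => χ (x 1) * θ (P x)) := by
  have hLP := embed_planarProj_add hP hL
  refine ⟨(hχ.comp (EuclideanSpace.proj (1 : Fin 3) :
      EuclideanSpace ℝ (Fin 3) →L[ℝ] ℝ).contDiff).mul (hθ.contDiff.comp P.contDiff), ?_, by simp⟩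
  set Θ : EuclideanSpace ℝ (Fin 2) × ℝ → EuclideanSpace ℝ (Fin 3) :=
    fun q => L q.1 + EuclideanSpace.single 1 q.2 with hΘ
  have hΘc : Continuous Θ :=
    (L.continuous.comp continuous_fst).add (continuous_single_one.comp continuous_snd)
  have hK : IsCompact (Θ '' (tsupport θ ×ˢ tsupport χ)) :=
    (hθ.hasCompactSupport.prod hχc).image hΘc
  refine HasCompactSupport.intro hK fun x hx => ?_
  by_contra hne
  have h1 : χ (x 1) ≠ 0 := fun h => hne (by rw [h, zero_mul])
  have h2 : θ (P x) ≠ 0 := fun h => hne (by rw [h, mul_zero])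
  exact hx ⟨(P x, x 1), ⟨subset_tsupport _ h2, subset_tsupport _ h1⟩, hLP x⟩

/-- **Pairing with the gradient of the lifted scalar test function**:
`⟪u, ∇(χ(x₁) θ(Px))⟫ = χ(x₁) ⟪Pu, ∇θ(Px)⟫ + χ'(x₁) θ(Px) u₁`. [folklore] -/
theorem inner_gradient_bumpLift_scalar
    {θ : EuclideanSpace ℝ (Fin 2) → ℝ} (hθ : ContDiff ℝ 1 θ) {χ : ℝ → ℝ} (hχ : ContDiff ℝ 1 χ)
    (u x : EuclideanSpace ℝ (Fin 3)) :
    ⟪u, gradient (fun x : EuclideanSpace ℝ (Fin 3) => χ (x 1) * θ (P x)) x⟫ =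
      χ (x 1) * ⟪P u, gradient θ (P x)⟫ + deriv χ (x 1) * θ (P x) * u 1 := by
  have hχd : DifferentiableAt ℝ χ (x 1) := (hχ.differentiable one_ne_zero) _
  have hθd : DifferentiableAt ℝ θ (P x) := (hθ.differentiable one_ne_zero) _
  have h1 : HasFDerivAt (fun x : EuclideanSpace ℝ (Fin 3) => χ (x 1))
      (deriv χ (x 1) • (EuclideanSpace.proj (1 : Fin 3) : EuclideanSpace ℝ (Fin 3) →L[ℝ] ℝ)) x :=
    hχd.hasDerivAt.comp_hasFDerivAt x
      ((EuclideanSpace.proj (1 : Fin 3) : EuclideanSpace ℝ (Fin 3) →L[ℝ] ℝ).hasFDerivAt)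
  have h2 : HasFDerivAt (fun x : EuclideanSpace ℝ (Fin 3) => θ (P x))
      ((fderiv ℝ θ (P x)).comp P) x :=
    hθd.hasFDerivAt.comp x P.hasFDerivAt
  have h : HasFDerivAt (fun x : EuclideanSpace ℝ (Fin 3) => χ (x 1) * θ (P x))
      (χ (x 1) • (fderiv ℝ θ (P x)).comp P + θ (P x) • (deriv χ (x 1) •
        (EuclideanSpace.proj (1 : Fin 3) : EuclideanSpace ℝ (Fin 3) →L[ℝ] ℝ))) x := h1.mul h2
  rw [real_inner_comm, gradient, InnerProductSpace.toDual_symm_apply, h.fderiv, real_inner_comm,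
    gradient, InnerProductSpace.toDual_symm_apply]
  simp only [_root_.FunLike.coe_add, Pi.add_apply, _root_.FunLike.coe_smul,
    Pi.smul_apply, smul_eq_mul, ContinuousLinearMap.comp_apply]
  simp
  ring

/-- `P (single 1 r) = 0`: the projection kills the ignorable direction. [folklore] -/
theorem planarProj_single_one (hP : ∀ v : EuclideanSpace ℝ (Fin 3), P v = toLp 2 ![v 0, v 2])
    (r : ℝ) : P (EuclideanSpace.single 1 r) = 0 := by
  rw [hP]; ext j; fin_cases j <;> simp

/-! ### The weak pairings along the lines parallel to `e₁` -/

/-- **The divergence constraint descends.** For a bounded continuous field `v` on `ℝ³`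
invariant under `x ↦ x + δe₁`, a planar test function `θ` and a bump `χ` with `∫ χ = 1`,
`∫ χ' = 0`: `∫ ⟪v, ∇(χ(x₁)θ(Px))⟫ dx = ∫ ⟪P v(L w), ∇θ(w)⟫ dw` (Fubini along the lines
parallel to `e₁`, `inner_gradient_bumpLift_scalar` on each line). [folklore] -/
theorem integral_inner_gradient_bumpLift_scalar_eq
    (hP : ∀ v : EuclideanSpace ℝ (Fin 3), P v = toLp 2 ![v 0, v 2])
    (hL : ∀ y : EuclideanSpace ℝ (Fin 2), L y = toLp 2 ![y 0, 0, y 1])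
    {θ : EuclideanSpace ℝ (Fin 2) → ℝ}
    (hθ : FunctionSpaces.IsTestFunctionOn (⊤ : Opens (EuclideanSpace ℝ (Fin 2))) θ)
    {χ : ℝ → ℝ} (hχ : ContDiff ℝ ∞ χ) (hχc : HasCompactSupport χ) (hχi : Integrable χ)
    (hχ1 : ∫ r, χ r = 1) (hχ'i : Integrable (deriv χ)) (hχ' : ∫ r, deriv χ r = 0)
    {v : EuclideanSpace ℝ (Fin 3) → EuclideanSpace ℝ (Fin 3)} (hvc : Continuous v) {C : ℝ}
    (hvC : ∀ x, ‖v x‖ ≤ C)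
    (hinv : ∀ (x : EuclideanSpace ℝ (Fin 3)) (δ : ℝ), v (x + EuclideanSpace.single 1 δ) = v x) :
    ∫ x, ⟪v x, gradient (fun x : EuclideanSpace ℝ (Fin 3) => χ (x 1) * θ (P x)) x⟫ =
      ∫ w, ⟪P (v (L w)), gradient θ w⟫ := by
  have hΘ := isTestFunctionOn_bumpLift_scalar hP hL hθ hχ hχc
  -- integrability on `ℝ³`
  have hgc : Continuous (gradient fun x : EuclideanSpace ℝ (Fin 3) => χ (x 1) * θ (P x)) :=
    continuous_gradient_of_contDiff (contDiff_infty.1 hΘ.contDiff 1)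
  have hgs : HasCompactSupport (gradient fun x : EuclideanSpace ℝ (Fin 3) => χ (x 1) * θ (P x)) :=
    hΘ.hasCompactSupport.fderiv (𝕜 := ℝ) |>.comp_left
      (g := fun l => (InnerProductSpace.toDual ℝ (EuclideanSpace ℝ (Fin 3))).symm l) (by simp)
  have hint : Integrable fun x => ⟪v x, gradient (fun x : EuclideanSpace ℝ (Fin 3) =>
      χ (x 1) * θ (P x)) x⟫ :=
    integrable_inner_of_aestronglyMeasurable_of_norm_le hvc.aestronglyMeasurable hvC
      (hgc.integrable_of_hasCompactSupport hgs)
  rw [integral_eq_integral_integral_line hint]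
  refine integral_congr_ae (Eventually.of_forall fun w => ?_)
  have hθ1 : ContDiff ℝ 1 θ := contDiff_infty.1 hθ.contDiff 1
  have hχ1' : ContDiff ℝ 1 χ := contDiff_infty.1 hχ 1
  have hpt : ∀ r : ℝ, ⟪v (toLp 2 ![w 0, r, w 1]), gradient (fun x : EuclideanSpace ℝ (Fin 3) =>
      χ (x 1) * θ (P x)) (toLp 2 ![w 0, r, w 1])⟫ =
      ⟪P (v (L w)), gradient θ w⟫ * χ r + (θ w * v (L w) 1) * deriv χ r := by
    intro r
    have hx : (toLp 2 ![w 0, r, w 1] : EuclideanSpace ℝ (Fin 3)) = L w + EuclideanSpace.single 1 r :=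
      toLp_line_eq_embed_add hL w r
    have hPx : P (toLp 2 ![w 0, r, w 1]) = w := by
      rw [hx, map_add, planarProj_embed hP hL, planarProj_single_one hP, add_zero]
    have hvx : v (toLp 2 ![w 0, r, w 1]) = v (L w) := by rw [hx, hinv]
    have hx1 : (toLp 2 ![w 0, r, w 1] : EuclideanSpace ℝ (Fin 3)) 1 = r := by simp
    rw [inner_gradient_bumpLift_scalar hθ1 hχ1', hPx, hvx, hx1]
    ring
  simp only [hpt]
  rw [integral_add (hχi.const_mul _) (hχ'i.const_mul _), integral_const_mul, integral_const_mul,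
    hχ1, hχ', mul_one, mul_zero, add_zero]

/-- **The weak Navier–Stokes pairing descends.** For a bounded continuous field `v` on `ℝ³`
invariant under `x ↦ x + δe₁`, a planar space–time test field `ψ`, a bump `χ` with `∫ χ = 1`,
`∫ χ' = ∫ χ'' = 0`, and the lifted field `Ψ(t, x) = χ(x₁) L ψ(t, Px)`:
`∫ (⟪v, ∂ₜΨ⟫ + ⟪v, (v·∇)Ψ⟫ + ν⟪v, ΔΨ⟫)(t, x) dx
  = ∫ (⟪V, ∂ₜψ⟫ + ⟪V, (V·∇)ψ⟫ + ν⟪V, Δψ⟫)(t, w) dw`, `V(w) = P v(L w)`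
(slice formulas `timeDeriv_bumpLift`, `hasFDerivAt_bumpLift`, `laplacian_bumpLift`; Fubini along
the lines parallel to `e₁`; the `χ'`- and `χ''`-terms integrate to zero). [folklore] -/
theorem integral_bumpLift_pairing_eq
    (hP : ∀ v : EuclideanSpace ℝ (Fin 3), P v = toLp 2 ![v 0, v 2])
    (hL : ∀ y : EuclideanSpace ℝ (Fin 2), L y = toLp 2 ![y 0, 0, y 1])
    {I : Set ℝ} {hI : IsOpen I} {ψ : ℝ → EuclideanSpace ℝ (Fin 2) → EuclideanSpace ℝ (Fin 2)}
    (hψ : IsSpaceTimeTestOn (slab (EuclideanSpace ℝ (Fin 2)) I hI) ψ)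
    {χ : ℝ → ℝ} (hχ : ContDiff ℝ ∞ χ) (hχc : HasCompactSupport χ) (hχi : Integrable χ)
    (hχ1 : ∫ r, χ r = 1) (hχ'i : Integrable (deriv χ)) (hχ' : ∫ r, deriv χ r = 0)
    (hχ''i : Integrable (deriv (deriv χ))) (hχ'' : ∫ r, deriv (deriv χ) r = 0)
    {v : EuclideanSpace ℝ (Fin 3) → EuclideanSpace ℝ (Fin 3)} (hvc : Continuous v) {C : ℝ}
    (hvC : ∀ x, ‖v x‖ ≤ C)
    (hinv : ∀ (x : EuclideanSpace ℝ (Fin 3)) (δ : ℝ), v (x + EuclideanSpace.single 1 δ) = v x)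
    (ν t : ℝ) :
    ∫ x, (⟪v x, timeDeriv (fun t (x : EuclideanSpace ℝ (Fin 3)) => χ (x 1) • L (ψ t (P x))) t x⟫ +
        ⟪v x, convect v (fun x : EuclideanSpace ℝ (Fin 3) => χ (x 1) • L (ψ t (P x))) x⟫ +
        ν * ⟪v x, Δ (fun x : EuclideanSpace ℝ (Fin 3) => χ (x 1) • L (ψ t (P x))) x⟫) =
      ∫ w, (⟪P (v (L w)), timeDeriv ψ t w⟫ +
        ⟪P (v (L w)), convect (fun w => P (v (L w))) (ψ t) w⟫ +
        ν * ⟪P (v (L w)), Δ (ψ t) w⟫) := by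
  have hΨ := isSpaceTimeTestOn_bumpLift (I := I) (hI := hI) hP hL hψ hχ hχc
  have hΨ' := hΨ.mono le_top
  -- integrability of the three terms on `ℝ³`
  have iT : Integrable (timeDeriv (fun t (x : EuclideanSpace ℝ (Fin 3)) =>
      χ (x 1) • L (ψ t (P x))) t) :=
    (hΨ'.timeDeriv_top.contDiff_slice t).continuous.integrable_of_hasCompactSupport
      (hΨ'.timeDeriv_top.hasCompactSupport_slice t)
  have iD : Integrable (fun x => fderiv ℝ (fun x : EuclideanSpace ℝ (Fin 3) =>
      χ (x 1) • L (ψ t (P x))) x) :=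
    (hΨ'.fderiv_top.contDiff_slice t).continuous.integrable_of_hasCompactSupport
      (hΨ'.fderiv_top.hasCompactSupport_slice t)
  have iΔ : Integrable (Δ (fun x : EuclideanSpace ℝ (Fin 3) => χ (x 1) • L (ψ t (P x)))) :=
    (hΨ'.laplacian_top.contDiff_slice t).continuous.integrable_of_hasCompactSupport
      (hΨ'.laplacian_top.hasCompactSupport_slice t)
  have i1 := integrable_inner_of_aestronglyMeasurable_of_norm_le hvc.aestronglyMeasurable hvC iT
  have i2 : Integrable fun x => ⟪v x, convect v (fun x : EuclideanSpace ℝ (Fin 3) =>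
      χ (x 1) • L (ψ t (P x))) x⟫ := by
    simp only [convect_apply]
    exact (integrable_inner_clm_apply_of_norm_le hvc.aestronglyMeasurable hvC iD).1
  have i3 := (integrable_inner_of_aestronglyMeasurable_of_norm_le hvc.aestronglyMeasurable hvC
    iΔ).const_mul ν
  have iG : Integrable fun x =>
      ⟪v x, timeDeriv (fun t (x : EuclideanSpace ℝ (Fin 3)) => χ (x 1) • L (ψ t (P x))) t x⟫ +
        ⟪v x, convect v (fun x : EuclideanSpace ℝ (Fin 3) => χ (x 1) • L (ψ t (P x))) x⟫ +
        ν * ⟪v x, Δ (fun x : EuclideanSpace ℝ (Fin 3) => χ (x 1) • L (ψ t (P x))) x⟫ :=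
    (i1.add i2).add i3
  rw [integral_eq_integral_integral_line iG]
  refine integral_congr_ae (Eventually.of_forall fun w => ?_)
  -- the slice regularity
  have hψ2 : ContDiff ℝ 2 (ψ t) := contDiff_infty.1 (hψ.contDiff_slice t) 2
  have hχ2 : ContDiff ℝ 2 χ := contDiff_infty.1 hχ 2
  have hider : ∀ r, iteratedDeriv 2 χ r = deriv (deriv χ) r := fun r => by
    rw [show (2 : ℕ) = 1 + 1 from rfl, iteratedDeriv_succ, iteratedDeriv_one]
  -- pointwise along the line through `(w₀, ·, w₁)`
  have hpt : ∀ r : ℝ,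
      ⟪v (toLp 2 ![w 0, r, w 1]), timeDeriv (fun t (x : EuclideanSpace ℝ (Fin 3)) =>
          χ (x 1) • L (ψ t (P x))) t (toLp 2 ![w 0, r, w 1])⟫ +
        ⟪v (toLp 2 ![w 0, r, w 1]), convect v (fun x : EuclideanSpace ℝ (Fin 3) =>
          χ (x 1) • L (ψ t (P x))) (toLp 2 ![w 0, r, w 1])⟫ +
        ν * ⟪v (toLp 2 ![w 0, r, w 1]), Δ (fun x : EuclideanSpace ℝ (Fin 3) =>
          χ (x 1) • L (ψ t (P x))) (toLp 2 ![w 0, r, w 1])⟫ =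
      (⟪P (v (L w)), timeDeriv ψ t w⟫ + ⟪P (v (L w)), convect (fun w => P (v (L w))) (ψ t) w⟫ +
          ν * ⟪P (v (L w)), Δ (ψ t) w⟫) * χ r +
        (v (L w) 1 * ⟪P (v (L w)), ψ t w⟫) * deriv χ r +
        (ν * ⟪P (v (L w)), ψ t w⟫) * deriv (deriv χ) r := by
    intro r
    have hx : (toLp 2 ![w 0, r, w 1] : EuclideanSpace ℝ (Fin 3)) = L w + EuclideanSpace.single 1 r :=
      toLp_line_eq_embed_add hL w r
    have hPx : P (toLp 2 ![w 0, r, w 1]) = w := by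
      rw [hx, map_add, planarProj_embed hP hL, planarProj_single_one hP, add_zero]
    have hvx : v (toLp 2 ![w 0, r, w 1]) = v (L w) := by rw [hx, hinv]
    have hx1 : (toLp 2 ![w 0, r, w 1] : EuclideanSpace ℝ (Fin 3)) 1 = r := by simp
    rw [timeDeriv_bumpLift hψ χ t, convect_apply, (hasFDerivAt_bumpLift hχ2 hψ2 _).fderiv,
      laplacian_bumpLift hP hχ2 hψ2, hPx, hvx, hx1, hider, convect_apply]
    simp only [_root_.FunLike.coe_add, Pi.add_apply, _root_.FunLike.coe_smul, Pi.smul_apply,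
      ContinuousLinearMap.comp_apply, ContinuousLinearMap.smulRight_apply, inner_add_right,
      inner_smul_right, inner_embed_right hP hL, smul_eq_mul]
    simp
    ring
  simp only [hpt]
  have j1 : Integrable fun r => (⟪P (v (L w)), timeDeriv ψ t w⟫ +
      ⟪P (v (L w)), convect (fun w => P (v (L w))) (ψ t) w⟫ + ν * ⟪P (v (L w)), Δ (ψ t) w⟫) * χ r :=
    hχi.const_mul _
  have j2 : Integrable fun r => (v (L w) 1 * ⟪P (v (L w)), ψ t w⟫) * deriv χ r := hχ'i.const_mul _
  have j3 : Integrable fun r => (ν * ⟪P (v (L w)), ψ t w⟫) * deriv (deriv χ) r :=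
    hχ''i.const_mul _
  have j12 : Integrable fun r => (⟪P (v (L w)), timeDeriv ψ t w⟫ +
      ⟪P (v (L w)), convect (fun w => P (v (L w))) (ψ t) w⟫ + ν * ⟪P (v (L w)), Δ (ψ t) w⟫) * χ r +
      (v (L w) 1 * ⟪P (v (L w)), ψ t w⟫) * deriv χ r := j1.add j2
  rw [integral_add j12 j3, integral_add j1 j2, integral_const_mul, integral_const_mul,
    integral_const_mul, hχ1, hχ', hχ'', mul_one, mul_zero, mul_zero, add_zero, add_zero]

end Gadgets

/-! ### The descent theorem -/

section Descent

/-- **Descent of bounded weak solutions along an ignorable coordinate** (folklore; the weak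
class of Koch–Nadirashvili–Seregin–Šverák 2009, §4 (ii), arXiv p. 8; cf. Majda–Bertozzi 2002,
§2.3.1 on `2½`-dimensional flows). Let `u` be a bounded weak solution of the Navier–Stokes
equations with viscosity `ν` on `ℝ³ × I` (`IsBoundedWeakNSSolutionOn`), jointly continuous on
`I × ℝ³`, invariant under the translations `x ↦ x + δe₁` along the Lean coordinate `1`, with
weakly divergence-free slices. Then its planar trace `V(t, y) = (u₀, u₂)(t, (y₀, 0, y₁))` is a
bounded weak solution on `ℝ² × I`: measurability and the bound are immediate; a planar test
function `θ` (resp. a planar divergence-free space–time test field `ψ`) is tested against `V`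
by testing the lift `χ(x₁)θ(Px)` (resp. `χ(x₁) L ψ(t, Px)`, divergence free by
`divergence_bumpLift`) against `u`, `χ` a normalised bump, and the `ℝ³` pairings equal the
planar ones (`integral_inner_gradient_bumpLift_scalar_eq`, `integral_bumpLift_pairing_eq`). [cite: KochNadirashviliSereginSverak2009, §4 (ii) (arXiv p. 8)] -/
theorem IsBoundedWeakNSSolutionOn.planarTrace_of_lineInvariant {I : Set ℝ} {hI : IsOpen I} {ν : ℝ}
    {u : ℝ → EuclideanSpace ℝ (Fin 3) → EuclideanSpace ℝ (Fin 3)}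
    (hu : IsBoundedWeakNSSolutionOn I hI ν u) (hcont : ContinuousOn (uncurry u) (I ×ˢ univ))
    (hinv : ∀ t ∈ I, ∀ (x : EuclideanSpace ℝ (Fin 3)) (δ : ℝ),
      u t (x + EuclideanSpace.single 1 δ) = u t x)
    (hdiv : ∀ t ∈ I, IsWeaklyDivFree (u t)) :
    IsBoundedWeakNSSolutionOn I hI ν (fun t (y : EuclideanSpace ℝ (Fin 2)) =>
      (toLp 2 ![u t (toLp 2 ![y 0, 0, y 1]) 0, u t (toLp 2 ![y 0, 0, y 1]) 2] :
        EuclideanSpace ℝ (Fin 2))) := by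
  -- the gadgets
  set P : EuclideanSpace ℝ (Fin 3) →L[ℝ] EuclideanSpace ℝ (Fin 2) :=
    (EuclideanSpace.proj (0 : Fin 3)).smulRight (EuclideanSpace.single (0 : Fin 2) (1 : ℝ)) +
      (EuclideanSpace.proj (2 : Fin 3)).smulRight (EuclideanSpace.single (1 : Fin 2) (1 : ℝ))
    with hPdef
  set L : EuclideanSpace ℝ (Fin 2) →L[ℝ] EuclideanSpace ℝ (Fin 3) :=
    (EuclideanSpace.proj (0 : Fin 2)).smulRight (EuclideanSpace.single (0 : Fin 3) (1 : ℝ)) +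
      (EuclideanSpace.proj (1 : Fin 2)).smulRight (EuclideanSpace.single (2 : Fin 3) (1 : ℝ))
    with hLdef
  have hP : ∀ v : EuclideanSpace ℝ (Fin 3), P v = toLp 2 ![v 0, v 2] := by
    intro v; rw [hPdef]; ext j; fin_cases j <;> simp
  have hL : ∀ y : EuclideanSpace ℝ (Fin 2), L y = toLp 2 ![y 0, 0, y 1] := by
    intro y; rw [hLdef]; ext j; fin_cases j <;> simp
  have hV : (fun t (y : EuclideanSpace ℝ (Fin 2)) =>
      (toLp 2 ![u t (toLp 2 ![y 0, 0, y 1]) 0, u t (toLp 2 ![y 0, 0, y 1]) 2] :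
        EuclideanSpace ℝ (Fin 2))) = fun t y => P (u t (L y)) := by
    funext t y; rw [hP, hL]
  rw [hV]
  -- continuity
  have huc : ∀ t ∈ I, Continuous (u t) := fun t ht =>
    hcont.comp_continuous (f := fun x : EuclideanSpace ℝ (Fin 3) => (t, x)) (by fun_prop)
      fun x => ⟨ht, mem_univ _⟩
  have hVcont : ContinuousOn (uncurry fun t y => P (u t (L y))) (I ×ˢ univ) := by
    have h1 : ContinuousOn (fun p : ℝ × EuclideanSpace ℝ (Fin 2) => uncurry u (p.1, L p.2))
        (I ×ˢ univ) :=
      hcont.comp (continuous_fst.prodMk (L.continuous.comp continuous_snd)).continuousOn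
        fun p hp => ⟨hp.1, mem_univ _⟩
    exact P.continuous.comp_continuousOn h1
  obtain ⟨χ, hχ, hχc, hχi, hχ1, hχ'i, hχ', hχ''i, hχ''⟩ := exists_smooth_bump_integral_one
  obtain ⟨-, ⟨C, hC⟩, -, hweak⟩ := hu
  refine ⟨hVcont.aestronglyMeasurable (hI.measurableSet.prod MeasurableSet.univ),
    ⟨C, fun t ht y => (norm_planarProj_le hP _).trans (hC t ht (L y))⟩, ?_, fun ψ hψ hψdiv => ?_⟩
  · -- weak divergence-freeness of the slices, for every `t ∈ I`
    refine (ae_restrict_iff' hI.measurableSet).2 (Eventually.of_forall fun t ht θ hθ => ?_)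
    have key := hdiv t ht _ (isTestFunctionOn_bumpLift_scalar hP hL hθ hχ hχc)
    rw [integral_inner_gradient_bumpLift_scalar_eq hP hL hθ hχ hχc hχi hχ1 hχ'i hχ' (huc t ht)
      (fun x => hC t ht x) (hinv t ht)] at key
    exact key
  · -- the weak identity
    have hΨ := isSpaceTimeTestOn_bumpLift (I := I) (hI := hI) hP hL hψ hχ hχc
    have hΨdiv : ∀ t, VectorCalculus.IsDivFree
        ((fun t (x : EuclideanSpace ℝ (Fin 3)) => χ (x 1) • L (ψ t (P x))) t) := by
      intro t x
      have hψ2 : ContDiff ℝ 2 (ψ t) := contDiff_infty.1 (hψ.contDiff_slice t) 2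
      have hχ2 : ContDiff ℝ 2 χ := contDiff_infty.1 hχ 2
      change VectorCalculus.divergence (fun x : EuclideanSpace ℝ (Fin 3) =>
        χ (x 1) • L (ψ t (P x))) x = 0
      rw [divergence_bumpLift hP hL hχ2 hψ2, hψdiv t (P x), mul_zero]
    have key := hweak _ hΨ hΨdiv
    rw [← key]
    refine (setIntegral_congr_fun hI.measurableSet fun t ht => ?_).symm
    exact integral_bumpLift_pairing_eq hP hL hψ hχ hχc hχi hχ1 hχ'i hχ' hχ''i hχ'' (huc t ht)
      (fun x => hC t ht x) (hinv t ht) ν t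

end Descent

/-! ### The planar half, the Liouville step and its reduction to §4 -/

/-- **The planar half of the Liouville step of KNSS Theorem 6.2 from Theorem 5.1 as printed**:
`KNSS2009_liouville_planar → KNSS2009_typeI_rate_liouville_horizontal`. The field `W` of the
fact is an Oseen-mild bounded continuous ancient field, hence a bounded weak solution on
`ℝ³ × (−∞, 0)` (`isBoundedWeakNSSolutionOn_of_oseen`); it is independent of `x₁`, so its
planar trace is a bounded weak solution on `ℝ² × (−∞, 0)`
(`IsBoundedWeakNSSolutionOn.planarTrace_of_lineInvariant`); then Theorem 5.1, continuity,
Remark 6.1 and the decay (`KNSS2009_typeI_rate_liouville_horizontal_of_weak_planar`). [cite: KochNadirashviliSereginSverak2009, proof of Thm 6.2 (arXiv p. 13) with Thm 5.1 (p. 9) and Remark 6.1 (p. 11)] -/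
theorem KNSS2009_typeI_rate_liouville_horizontal_of_planar (h51 : KNSS2009_liouville_planar) :
    KNSS2009_typeI_rate_liouville_horizontal := by
  intro C W hcont hbdd hdiv hmild hinv hdecay
  have hmild' : ∀ s t : ℝ, s < t → t < 0 → ∀ x,
      W t x = UnboundedOperators.heatExtension (W s) (1 * (t - s)) x - oseenDuhamel 1 s W W t x := by
    intro s t hst ht x
    rw [one_mul]
    exact hmild s t hst ht x
  have hweak := isBoundedWeakNSSolutionOn_of_oseen one_pos hcont hbdd hdiv hmild'
  have hV := hweak.planarTrace_of_lineInvariant hcont (fun t ht => hinv t ht) fun t ht => hdiv t ht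
  exact KNSS2009_typeI_rate_liouville_horizontal_of_weak_planar h51 hcont hbdd hmild hinv hdecay hV

/-- **The Liouville step of the proof of KNSS Theorem 6.2 from Theorem 5.1 as printed**:
`KNSS2009_liouville_planar → KNSS2009_typeI_rate_liouville` (the planar half
`KNSS2009_typeI_rate_liouville_horizontal_of_planar` and the proved axial half,
`KNSS2009_typeI_rate_liouville_of_horizontal`). [cite: KochNadirashviliSereginSverak2009, proof of Thm 6.2 (arXiv p. 13)] -/
theorem KNSS2009_typeI_rate_liouville_of_planar (h51 : KNSS2009_liouville_planar) :
    KNSS2009_typeI_rate_liouville :=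
  KNSS2009_typeI_rate_liouville_of_horizontal (KNSS2009_typeI_rate_liouville_horizontal_of_planar h51)

/-- **The Liouville step of the proof of KNSS Theorem 6.2 from the §4 regularity of planar
bounded weak solutions**: since Theorem 5.1 is reduced in the tree to the planar §4 fact
(`KNSS2009_liouville_planar_of_regularity`, `KNSSLiouvillePlanar`, Lemma 2.1 being proved),
`KNSS2009_regularity_boundedWeak_ancient_planar → KNSS2009_typeI_rate_liouville`. This is the
current trust base of the Liouville ingredient of Steps 5–6 of the proof of Theorem 6.2. [cite: KochNadirashviliSereginSverak2009, proof of Thm 6.2 (arXiv p. 13) with §4 (p. 8) and Thm 5.1 (p. 9)] -/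
theorem KNSS2009_typeI_rate_liouville_of_regularity_planar
    (hreg : KNSS2009_regularity_boundedWeak_ancient_planar) : KNSS2009_typeI_rate_liouville :=
  KNSS2009_typeI_rate_liouville_of_planar (KNSS2009_liouville_planar_of_regularity hreg)

/-- **KNSS 2009, Theorem 6.2 as vendored, with the Liouville ingredient replaced by its trust
base**: from Theorem 6.1 (`KNSS2009_regularity_bound_C_over_r`), the compactness ingredient,
the planar §4 regularity fact (for the Liouville step, via
`KNSS2009_typeI_rate_liouville_of_regularity_planar`) and the vertex estimate
(`KNSS2009_regularity_typeI_rate_of_core`, `KNSSTypeIRateCoreProofs`). [cite: KochNadirashviliSereginSverak2009, Thm 6.2 and its proof (arXiv pp. 12–13)] -/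
theorem KNSS2009_regularity_typeI_rate_of_core_of_regularity_planar
    (h61 : KNSS2009_regularity_bound_C_over_r) (h1 : KNSS2009_typeI_rate_compactness)
    (hreg : KNSS2009_regularity_boundedWeak_ancient_planar) (h3 : KNSS2009_typeI_rate_vertex) :
    KNSS2009_regularity_typeI_rate :=
  KNSS2009_regularity_typeI_rate_of_core h61 h1
    (KNSS2009_typeI_rate_liouville_of_regularity_planar hreg) h3

/-- **The Liouville step of the proof of KNSS Theorem 6.2 from the §4 regularity of bounded
weak solutions on `ℝ³ × (−∞, 0)`**: the planar §4 fact behind Theorem 5.1 is reduced in the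
tree to the spatial one (`KNSS2009_liouville_planar_of_ancient`, `KNSSRegularityPlanarOfSpace`),
so `KNSS2009_regularity_boundedWeak_ancient → KNSS2009_typeI_rate_liouville` — the trust base
shared with the tree's Theorems 5.2–5.3. [cite: KochNadirashviliSereginSverak2009, proof of Thm 6.2 (arXiv p. 13) with §4 (p. 8) and Thm 5.1 (p. 9)] -/
theorem KNSS2009_typeI_rate_liouville_of_regularity_ancient
    (h3 : KNSS2009_regularity_boundedWeak_ancient) : KNSS2009_typeI_rate_liouville :=
  KNSS2009_typeI_rate_liouville_of_planar (KNSS2009_liouville_planar_of_ancient h3)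

end Literature.Analysis.FluidPDE

end
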